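import Summits.Ventures.PercRepro.ProfilePointedCircuitClassesStarNine

/-!
# PercRepro — THE TWO-PAIR CELL COUNT: ON ELEVEN POINTS WITH TWO DISJOINT SERIES PAIRS THE BI-INDEPENDENT 5-SETS ARE
COUNTED BY THE TWO NINE-POINT MINORS; THE PROP `StarNineSharp` (p5, gen 52; `proofs/P5-GM1.md` §79 ADDENDUM 2)

Let `N` have `#E = 11`, `ρ(E) = 6`, two disjoint series pairs `{b, b'}`, `{c, c'}`.  Every bi-independent `5`-set
meets at least one of the pairs (a set avoiding all four points lies in the rank-`4` set `E − b − b' − c − c'`: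
`mem_of_mem_biIndepSets_of_two_seriesPairs`), so the nine cells of the membership pattern (`b`-pair, `c`-pair) reduce
to four: through both pairs (`4×`), through `b` only (`2×`), through `c` only (`2×`).  With `Q := N ／ b ∖ b'` and
`P := N ／ c ∖ c'` (nine points, rank `5`, each keeping the other pair — StarSharpM's `seriesPair_minor_of_seriesPair` — and
coloop-free when `N` is and no series triple passes through `b'` / `c'` — module StarSharpM), for
every predicate `p` invariant under the swaps and the lifts:
  **`#{W ∈ BI_5(N) : p} + 4·#{Y ∈ BI_4(Q) : p, c ∈ Y} = 2·#{Y ∈ BI_4(Q) : p} + 2·#{Y ∈ BI_4(P) : p}`**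
(`card_filter_eq_of_two_seriesPairs`).  The module StarSharpD turns it into (★) on `N` from the Sharp statement on the
two minors.  The Sharp statement at `(9, 5)` is the Prop **`StarNineSharp`** (a CONJECTURE def, NOT asserted), a FINITE
statement decided by the engine's complete catalogue of eight-element matroids (every nine-point rank-`5` matroid with
a series pair is the series extension of an eight-point rank-`4` one: all 940 × 8 marks, 279,552 ordered pairs
`(e, f)`, 0 violations, 34,335 tight; §79 ADD 2).  CAUTION: the `(11, 6)` Sharp statement `StarElevenSharp` of the
module StarSharp is FALSE (§79 ADD 1); nothing here uses it, and this module imports StarNine only (the three small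
StarSharp lemmas it needs are re-proved here under primed names).
-/

open scoped Matroid

namespace PercRepro.Cogirth

open Finset ThmH Skew Shadow Profile

variable {α : Type} [DecidableEq α] {N : Matroid α} [N.Finite]

section StarSharpC

/-- **THE SHARP (★) AT `(9, 5)` ALONG A SERIES PAIR** (a CONJECTURE `Prop`, NOT asserted): on every coloop-free matroid
with `#E = 9`, `ρ(E) = 5`, a series pair `{b, b'}` and two further distinct points `e, f` outside it,
`in_4(e) + thru_4({b', f}) + thru_4({b', e, f}) ≤ in_4(f) + thru_4({e, f}) + thru_4({b', e})` — the part of (★) at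
`(e, f)` carried by the bi-independent `4`-sets avoiding `b'`.  Exhaustively true on the complete eight-element
catalogue (§79(c)). -/
def StarNineSharp (α : Type) [DecidableEq α] : Prop :=
  ∀ (N : Matroid α) [N.Finite], (gr N).card = 9 → rk N (gr N) = 5 →
    (∀ x ∈ gr N, rk N ((gr N).erase x) = 5) →
    ∀ b b' e f : α, SeriesPair N b b' → e ∈ gr N → f ∈ gr N → e ≠ f → e ≠ b → e ≠ b' → f ≠ b → f ≠ b' →
      inCount N 4 e + thruCount N 4 {b', f} + thruCount N 4 {b', e, f} ≤
        inCount N 4 f + thruCount N 4 {e, f} + thruCount N 4 {b', e}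

/-- `S ⊆ W − x + y ↔ S ⊆ W` when `x, y ∉ S` (a copy of the StarSharp lemma, so that this module depends on the
StarNine olean only). -/
theorem subset_insert_erase_iff_of_notMem' {S W : Finset α} {x y : α} (hxS : x ∉ S) (hyS : y ∉ S) :
    S ⊆ insert y (W.erase x) ↔ S ⊆ W := by
  constructor
  · intro hS z hz
    have hz' := hS hz
    rw [mem_insert, mem_erase] at hz'
    rcases hz' with hzy | hzW
    · exact absurd (hzy ▸ hz) hyS
    · exact hzW.2
  · intro hS z hz
    exact mem_insert_of_mem (mem_erase.2 ⟨fun hzx => hxS (hzx ▸ hz), hS hz⟩)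

/-- `S ⊆ Y + x ↔ S ⊆ Y` when `x ∉ S` (a copy of the StarSharp lemma). -/
theorem subset_insert_iff_of_notMem' {S Y : Finset α} {x : α} (hxS : x ∉ S) :
    S ⊆ insert x Y ↔ S ⊆ Y := by
  constructor
  · intro hS z hz
    have hz' := hS hz
    rw [mem_insert] at hz'
    rcases hz' with hzx | hzY
    · exact absurd (hzx ▸ hz) hxS
    · exact hzY
  · intro hS
    exact hS.trans (subset_insert _ _)

/-- `thru_{k+1}(S + b') = thru_k^{N ／ b ∖ b'}(S)` for a series pair `{b, b'}` and `S ⊆ E − b − b'` (a copy of the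
StarSharp lemma `thruCount_insert_eq_thruCount_minor_of_seriesPair`: the sets through `b'` avoid `b`, the swap takes
them to the sets through `b`, which are the lifts of the minor's sets). -/
theorem thruCount_insert_eq_thruCount_minor_of_seriesPair' {b b' : α} (h : SeriesPair N b b') {k : ℕ}
    (hn : (gr N).card = rk N (gr N) + (k + 1)) {S : Finset α} (hbS : b ∉ S) (hb'S : b' ∉ S) :
    thruCount N (k + 1) (insert b' S) = thruCount ((N ／ ({b} : Set α)) ＼ ({b'} : Set α)) k S := by
  have h1 : thruCount N (k + 1) (insert b' S) =
      ((biIndepSets N (k + 1)).filter (fun W => (S ⊆ W ∧ b ∉ W) ∧ b' ∈ W)).card := by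
    unfold thruCount
    apply congrArg
    apply filter_congr
    intro W hW
    rw [insert_subset_iff]
    constructor
    · rintro ⟨hb'W, hSW⟩
      exact ⟨⟨hSW, not_mem_of_mem_biIndepSets_of_seriesPair h.symm hn hW hb'W⟩, hb'W⟩
    · rintro ⟨⟨hSW, _⟩, hb'W⟩
      exact ⟨hb'W, hSW⟩
  have h2 := card_filter_swap_of_seriesPair h (k + 1) (fun W => S ⊆ W)
    (fun W => subset_insert_erase_iff_of_notMem' hbS hb'S)
    (fun W => subset_insert_erase_iff_of_notMem' hb'S hbS)
  have h3 := card_filter_minor_insert_left_eq_of_seriesPair h k (fun Y => S ⊆ Y)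
    (fun Y => subset_insert_iff_of_notMem' hbS)
  rw [h1, ← h2, ← h3]
  rfl

/-- `thru_{k+1}(S + b) = thru_k^{N ／ b ∖ b'}(S)` (the sets through `b` avoid `b'` and are the lifts of the minor's
sets). -/
theorem thruCount_insert_left_eq_thruCount_minor_of_seriesPair {b b' : α} (h : SeriesPair N b b') {k : ℕ}
    (hn : (gr N).card = rk N (gr N) + (k + 1)) {S : Finset α} (hbS : b ∉ S) :
    thruCount N (k + 1) (insert b S) = thruCount ((N ／ ({b} : Set α)) ＼ ({b'} : Set α)) k S := by
  have h1 : thruCount N (k + 1) (insert b S) =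
      ((biIndepSets N (k + 1)).filter (fun W => (S ⊆ W ∧ b ∈ W) ∧ b' ∉ W)).card := by
    unfold thruCount
    apply congrArg
    apply filter_congr
    intro W hW
    rw [insert_subset_iff]
    constructor
    · rintro ⟨hbW, hSW⟩
      exact ⟨⟨hSW, hbW⟩, not_mem_of_mem_biIndepSets_of_seriesPair h hn hW hbW⟩
    · rintro ⟨⟨hSW, hbW⟩, _⟩
      exact ⟨hbW, hSW⟩
  have h3 := card_filter_minor_insert_left_eq_of_seriesPair h k (fun Y => S ⊆ Y)
    (fun Y => subset_insert_iff_of_notMem' hbS)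
  rw [h1, ← h3]
  rfl

/-- **NO BI-INDEPENDENT `5`-SET AVOIDS TWO DISJOINT SERIES PAIRS** on `#E = 11`, `ρ(E) = 6`: such a set would lie in
`E − b − b' − c − c'`, whose rank is at most `4` (`c ∉ cl(E − b − b' − c − c')` and `E − b − b'` has rank `5`). -/
theorem mem_of_mem_biIndepSets_of_two_seriesPairs (hR : rk N (gr N) = 6)
    {b b' c c' : α} (h : SeriesPair N b b') (h' : SeriesPair N c c') (hbc : b ≠ c) (hb'c : b' ≠ c)
    {W : Finset α} (hW : W ∈ biIndepSets N 5) :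
    b ∈ W ∨ b' ∈ W ∨ c ∈ W ∨ c' ∈ W := by
  by_contra hcon
  simp only [not_or] at hcon
  obtain ⟨hbW, hb'W, hcW, hc'W⟩ := hcon
  obtain ⟨hWg, hWc, hWr, _⟩ := mem_biIndepSets.1 hW
  have hsub : W ⊆ (((((gr N).erase b).erase b').erase c).erase c') := by
    intro y hy
    simp only [mem_erase]
    exact ⟨fun h'' => hc'W (h'' ▸ hy), fun h'' => hcW (h'' ▸ hy), fun h'' => hb'W (h'' ▸ hy),
      fun h'' => hbW (h'' ▸ hy), hWg hy⟩
  have h1 : rk N W ≤ rk N (((((gr N).erase b).erase b').erase c).erase c') := rk_mono' (M := N) hsub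
  have hsub2 : ((((gr N).erase b).erase b').erase c).erase c' ⊆ ((gr N).erase c).erase c' := by
    intro y hy
    simp only [mem_erase] at hy ⊢
    exact ⟨hy.1, hy.2.1, hy.2.2.2.2⟩
  have h2 := rk_insert_left_eq_add_one_of_seriesPair h' hsub2
  have hsub3 : insert c (((((gr N).erase b).erase b').erase c).erase c') ⊆ ((gr N).erase b).erase b' := by
    intro y hy
    rw [mem_insert] at hy
    rcases hy with rfl | hy
    · exact mem_erase.2 ⟨hb'c.symm, mem_erase.2 ⟨hbc.symm, h'.1⟩⟩
    · simp only [mem_erase] at hy ⊢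
      exact ⟨hy.2.2.1, hy.2.2.2⟩
  have h3 : rk N (insert c (((((gr N).erase b).erase b').erase c).erase c')) ≤ rk N (((gr N).erase b).erase b') :=
    rk_mono' (M := N) hsub3
  have h4 := h.2.2.2.2.2
  omega

/-- **THE TWO-PAIR CELL COUNT**: on `#E = 11`, `ρ(E) = 6` with disjoint series pairs `{b, b'}`, `{c, c'}` (the second
surviving in `Q := N ／ b ∖ b'` and the first in `P := N ／ c ∖ c'`), for a predicate `p` invariant under both swaps
and both lifts, `#{W ∈ BI_5(N) : p} + 4·#{Y ∈ BI_4(Q) : p ∧ c ∈ Y} = 2·#{Y ∈ BI_4(Q) : p} + 2·#{Y ∈ BI_4(P) : p}`. -/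
theorem card_filter_eq_of_two_seriesPairs (hn : (gr N).card = 11) (hR : rk N (gr N) = 6) {b b' c c' : α}
    (h : SeriesPair N b b') (h' : SeriesPair N c c') (hbc : b ≠ c) (hbc' : b ≠ c') (hb'c : b' ≠ c)
    (hb'c' : b' ≠ c') (hP : SeriesPair ((N ／ ({c} : Set α)) ＼ ({c'} : Set α)) b b')
    (p : Finset α → Prop) [DecidablePred p]
    (hpb : ∀ W, p (insert b' (W.erase b)) ↔ p W) (hpb' : ∀ W, p (insert b (W.erase b')) ↔ p W)
    (hpc : ∀ W, p (insert c' (W.erase c)) ↔ p W) (hpc' : ∀ W, p (insert c (W.erase c')) ↔ p W)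
    (hlb : ∀ Y, p (insert b Y) ↔ p Y) (hlc : ∀ Y, p (insert c Y) ↔ p Y) :
    ((biIndepSets N 5).filter p).card +
        4 * ((biIndepSets ((N ／ ({b} : Set α)) ＼ ({b'} : Set α)) 4).filter (fun Y => p Y ∧ c ∈ Y)).card =
      2 * ((biIndepSets ((N ／ ({b} : Set α)) ＼ ({b'} : Set α)) 4).filter p).card +
        2 * ((biIndepSets ((N ／ ({c} : Set α)) ＼ ({c'} : Set α)) 4).filter p).card := by
  have hn5 : (gr N).card = rk N (gr N) + 5 := by omega
  -- the `b`-split of `BI_5(N)`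
  have hSb := card_filter_eq_sum_four (biIndepSets N 5) p b b'
  have hboth_b : ((biIndepSets N 5).filter (fun W => (p W ∧ b ∈ W) ∧ b' ∈ W)).card = 0 := by
    rw [card_eq_zero, filter_eq_empty_iff]
    intro W hW hc
    exact not_mem_of_mem_biIndepSets_of_seriesPair h hn5 hW hc.1.2 hc.2
  have hswap_b := card_filter_swap_of_seriesPair h 5 p hpb hpb'
  have htrans_b := card_filter_minor_insert_left_eq_of_seriesPair h 4 p hlb
  simp only [Nat.reduceAdd] at htrans_b
  -- the `c`-split of the cell avoiding `b, b'`
  have hSc := card_filter_eq_sum_four (biIndepSets N 5) (fun W => (p W ∧ b ∉ W) ∧ b' ∉ W) c c'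
  have hboth_c : ((biIndepSets N 5).filter (fun W => (((p W ∧ b ∉ W) ∧ b' ∉ W) ∧ c ∈ W) ∧ c' ∈ W)).card = 0 := by
    rw [card_eq_zero, filter_eq_empty_iff]
    intro W hW hc
    exact not_mem_of_mem_biIndepSets_of_seriesPair h' hn5 hW hc.1.2 hc.2
  have hnone : ((biIndepSets N 5).filter (fun W => (((p W ∧ b ∉ W) ∧ b' ∉ W) ∧ c ∉ W) ∧ c' ∉ W)).card = 0 := by
    rw [card_eq_zero, filter_eq_empty_iff]
    intro W hW hc
    rcases mem_of_mem_biIndepSets_of_two_seriesPairs hR h h' hbc hb'c hW with h1 | h1 | h1 | h1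
    · exact hc.1.1.1.2 h1
    · exact hc.1.1.2 h1
    · exact hc.1.2 h1
    · exact hc.2 h1
  have hqc : ∀ W, ((p (insert c' (W.erase c)) ∧ b ∉ insert c' (W.erase c)) ∧ b' ∉ insert c' (W.erase c)) ↔
      ((p W ∧ b ∉ W) ∧ b' ∉ W) := by
    intro W
    rw [hpc]
    have e1 : b ∉ insert c' (W.erase c) ↔ b ∉ W := by
      rw [mem_insert, mem_erase]
      constructor
      · intro h1 h2; exact h1 (Or.inr ⟨hbc, h2⟩)
      · rintro h1 (h2 | h2)
        · exact hbc' h2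
        · exact h1 h2.2
    have e2 : b' ∉ insert c' (W.erase c) ↔ b' ∉ W := by
      rw [mem_insert, mem_erase]
      constructor
      · intro h1 h2; exact h1 (Or.inr ⟨hb'c, h2⟩)
      · rintro h1 (h2 | h2)
        · exact hb'c' h2
        · exact h1 h2.2
    rw [e1, e2]
  have hqc' : ∀ W, ((p (insert c (W.erase c')) ∧ b ∉ insert c (W.erase c')) ∧ b' ∉ insert c (W.erase c')) ↔
      ((p W ∧ b ∉ W) ∧ b' ∉ W) := by
    intro W
    rw [hpc']
    have e1 : b ∉ insert c (W.erase c') ↔ b ∉ W := by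
      rw [mem_insert, mem_erase]
      constructor
      · intro h1 h2; exact h1 (Or.inr ⟨hbc', h2⟩)
      · rintro h1 (h2 | h2)
        · exact hbc h2
        · exact h1 h2.2
    have e2 : b' ∉ insert c (W.erase c') ↔ b' ∉ W := by
      rw [mem_insert, mem_erase]
      constructor
      · intro h1 h2; exact h1 (Or.inr ⟨hb'c', h2⟩)
      · rintro h1 (h2 | h2)
        · exact hb'c h2
        · exact h1 h2.2
    rw [e1, e2]
  have hswap_c := card_filter_swap_of_seriesPair h' 5 (fun W => (p W ∧ b ∉ W) ∧ b' ∉ W) hqc hqc'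
  have hlcq : ∀ Y, ((p (insert c Y) ∧ b ∉ insert c Y) ∧ b' ∉ insert c Y) ↔ ((p Y ∧ b ∉ Y) ∧ b' ∉ Y) := by
    intro Y
    rw [hlc]
    have e1 : b ∉ insert c Y ↔ b ∉ Y := by
      rw [mem_insert]
      constructor
      · intro h1 h2; exact h1 (Or.inr h2)
      · rintro h1 (h2 | h2)
        · exact hbc h2
        · exact h1 h2
    have e2 : b' ∉ insert c Y ↔ b' ∉ Y := by
      rw [mem_insert]
      constructor
      · intro h1 h2; exact h1 (Or.inr h2)
      · rintro h1 (h2 | h2)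
        · exact hb'c h2
        · exact h1 h2
    rw [e1, e2]
  have htrans_c := card_filter_minor_insert_left_eq_of_seriesPair h' 4 (fun W => (p W ∧ b ∉ W) ∧ b' ∉ W) hlcq
  simp only [Nat.reduceAdd] at htrans_c
  -- the `b`-split inside `P`
  have hnP : (gr ((N ／ ({c} : Set α)) ＼ ({c'} : Set α))).card =
      rk ((N ／ ({c} : Set α)) ＼ ({c'} : Set α)) (gr ((N ／ ({c} : Set α)) ＼ ({c'} : Set α))) + 4 := by
    have h1 := card_gr_minor_add_two_of_seriesPair h'
    have h2 := rk_gr_minor_add_one_of_seriesPair h'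
    omega
  have hSP := card_filter_eq_sum_four (biIndepSets ((N ／ ({c} : Set α)) ＼ ({c'} : Set α)) 4) p b b'
  have hbothP : ((biIndepSets ((N ／ ({c} : Set α)) ＼ ({c'} : Set α)) 4).filter
      (fun W => (p W ∧ b ∈ W) ∧ b' ∈ W)).card = 0 := by
    rw [card_eq_zero, filter_eq_empty_iff]
    intro W hW hc
    exact not_mem_of_mem_biIndepSets_of_seriesPair hP hnP hW hc.1.2 hc.2
  have hswapP := card_filter_swap_of_seriesPair hP 4 p hpb hpb'
  -- the cell through `b` of `P` is the cell through `b` and `c` of `N`, which is the cell through `c` of `Q`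
  have hlPb : ∀ Y, ((p (insert c Y) ∧ b ∈ insert c Y) ∧ b' ∉ insert c Y) ↔ ((p Y ∧ b ∈ Y) ∧ b' ∉ Y) := by
    intro Y
    have e1 : b ∈ insert c Y ↔ b ∈ Y := by
      rw [mem_insert]
      constructor
      · rintro (h1 | h1)
        · exact absurd h1 hbc
        · exact h1
      · exact fun h1 => Or.inr h1
    have e2 : b' ∉ insert c Y ↔ b' ∉ Y := by
      rw [mem_insert]
      constructor
      · intro h1 h2; exact h1 (Or.inr h2)
      · rintro h1 (h2 | h2)
        · exact hb'c h2
        · exact h1 h2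
    rw [hlc, e1, e2]
  have htransPb := card_filter_minor_insert_left_eq_of_seriesPair h' 4 (fun W => (p W ∧ b ∈ W) ∧ b' ∉ W) hlPb
  simp only [Nat.reduceAdd] at htransPb
  have hlQc : ∀ Y, (p (insert b Y) ∧ c ∈ insert b Y) ↔ (p Y ∧ c ∈ Y) := by
    intro Y
    have e1 : c ∈ insert b Y ↔ c ∈ Y := by
      rw [mem_insert]
      constructor
      · rintro (h1 | h1)
        · exact absurd h1 hbc.symm
        · exact h1
      · exact fun h1 => Or.inr h1
    rw [hlb, e1]
  have htransQc := card_filter_minor_insert_left_eq_of_seriesPair h 4 (fun Y => p Y ∧ c ∈ Y) hlQc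
  simp only [Nat.reduceAdd] at htransQc
  have hsame : ((biIndepSets N 5).filter (fun W => (((p W ∧ b ∈ W) ∧ b' ∉ W) ∧ c ∈ W) ∧ c' ∉ W)).card =
      ((biIndepSets N 5).filter (fun W => ((p W ∧ c ∈ W) ∧ b ∈ W) ∧ b' ∉ W)).card := by
    apply congrArg
    apply filter_congr
    intro W hW
    constructor
    · rintro ⟨⟨⟨⟨hpW, hbW⟩, hb'W⟩, hcW⟩, _⟩
      exact ⟨⟨⟨hpW, hcW⟩, hbW⟩, hb'W⟩
    · rintro ⟨⟨⟨hpW, hcW⟩, hbW⟩, hb'W⟩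
      exact ⟨⟨⟨⟨hpW, hbW⟩, hb'W⟩, hcW⟩, not_mem_of_mem_biIndepSets_of_seriesPair h' hn5 hW hcW⟩
  beta_reduce at hSb hSc hSP hboth_b hboth_c hnone hswap_b hswap_c hswapP htrans_b htrans_c htransPb htransQc hsame
  omega

end StarSharpC

end PercRepro.Cogirth
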